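import Mathlib
import Summits.ValiantsHypothesis.ValiantsHypothesis.Theorems.KPlusLogSqLawReachThreeNoSecondStep

/-!
# The STEP LEMMA in pair form for the static path model behind `KPlusLogSqLaw.TropicalB`

Cell pub-symmetroid, seat conjb-2 (g21). A helper toward the crux `TropicalB`
(`Summit.ValiantsHypothesis.ValiantsHypothesis.Theses.KPlusLogSqLaw.TropicalB`, item
`stmt-ValiantsHypothesis-19771`); it earns no crux credit and is not evidence for `MatrixDescartes` or for
Valiant's hypothesis.

Setting (THEORY-NOTE-g21 of the cell, §1–§3). Lines `S t θ = b t + s t * θ` indexed by `t : ℕ`; a window of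
consecutive lines is *separated* at `θ` when every even-indexed line of the window lies strictly above every
odd-indexed line of the window at `θ`. In the static corridor calculus of the HullDComb model rung a *step* at a row
is the event that the window `[i, i+d]` is separated somewhere, the shifted window `[i+1, i+d+1]` is separated
somewhere, but no `θ` separates both. The two kernel lemmas already landed for reach three
(`KPlusLogSqLawReachThreeStep.reach3_step_forces`, `KPlusLogSqLawReachThreeNoSecondStep.reach3_no_second_step`) analyse
this event by hand for `d = 3`. The present file records the general first move for every reach `d`:

* `step_pair` : a step is always witnessed by ONE incompatible pair of comparisons — an even/odd comparison of the
  window `[i, i+d]` through the line `i` and an even/odd comparison of the window `[i+1, i+d+1]` through the line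
  `i+d+1` whose solution sets (two open half-lines) are disjoint. This is Helly's theorem in dimension one
  (Mathlib's `Convex.helly_theorem'` with `finrank ℝ ℝ = 1`) applied to the family of all even/odd comparisons of the two
  windows: comparisons inside both windows are jointly satisfiable, so an unsatisfiable pair must use one comparison
  private to each window, and a comparison private to `[i, i+d]` (resp. `[i+1, i+d+1]`) involves the line `i`
  (resp. `i+d+1`).
* `two_halfLines_disjoint` : the slope reading of an incompatible pair — two affine functions, each positive
  somewhere, are never simultaneously positive only if their slopes have strictly opposite signs, and then every
  positivity point of the decreasing one lies to the left of every positivity point of the increasing one.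

Together they reduce the step analysis at any reach to finitely many sign patterns (for `d = 3` this is how LEMMA S3
was found); no parity hypothesis on `d` is needed for `step_pair` itself.
-/

set_option linter.dupNamespace false

namespace Summit.ValiantsHypothesis.ValiantsHypothesis.Theorems.KPlusLogSqLawStepPair

open Finset
open Summit.ValiantsHypothesis.ValiantsHypothesis.Theorems.KPlusLogSqLawReachThreeNoSecondStep (affine_pos_of_le)

/-- An affine function with non-positive slope stays positive to the left of a point of positivity. -/
theorem affine_pos_of_ge (x θ fa fb : ℝ) (hx : 0 < fa + fb * x) (hfb : fb ≤ 0) (h : θ ≤ x) :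
    0 < fa + fb * θ := by
  have p : 0 ≤ fb * (θ - x) := mul_nonneg_of_nonpos_of_nonpos hfb (by linarith)
  have i : fa + fb * θ = (fa + fb * x) + fb * (θ - x) := by ring
  linarith

/-- An affine function positive at two points is positive between them. -/
theorem affine_pos_between (x y θ fa fb : ℝ) (hx : 0 < fa + fb * x) (hy : 0 < fa + fb * y) (h1 : x ≤ θ)
    (h2 : θ ≤ y) : 0 < fa + fb * θ := by
  by_cases hfb : 0 ≤ fb
  · exact affine_pos_of_le x θ fa fb hx hfb h1
  · exact affine_pos_of_ge y θ fa fb hy (le_of_lt (not_le.mp hfb)) h2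

/-- SLOPE READING OF AN INCOMPATIBLE PAIR. Two affine functions `fa + fb θ` and `ga + gb θ`, each positive
somewhere, are never simultaneously positive only if their slopes have strictly opposite signs; moreover every
positivity point of the decreasing one lies strictly to the left of every positivity point of the increasing one. -/
theorem two_halfLines_disjoint (fa fb ga gb x y : ℝ) (hx : 0 < fa + fb * x) (hy : 0 < ga + gb * y)
    (h : ∀ θ : ℝ, ¬ (0 < fa + fb * θ ∧ 0 < ga + gb * θ)) :
    (fb < 0 ∧ 0 < gb ∧ ∀ θ θ' : ℝ, 0 < fa + fb * θ → 0 < ga + gb * θ' → θ < θ') ∨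
    (0 < fb ∧ gb < 0 ∧ ∀ θ θ' : ℝ, 0 < fa + fb * θ → 0 < ga + gb * θ' → θ' < θ) := by
  by_cases hfb : 0 ≤ fb
  · by_cases hgb : 0 ≤ gb
    · exfalso
      by_cases hxy : x ≤ y
      · exact h y ⟨affine_pos_of_le x y fa fb hx hfb hxy, hy⟩
      · exact h x ⟨hx, affine_pos_of_le y x ga gb hy hgb (le_of_lt (not_le.mp hxy))⟩
    · have hgb' : gb < 0 := not_le.mp hgb
      by_cases hfb0 : fb = 0
      · exfalso
        subst hfb0
        exact h y ⟨by simpa using hx, hy⟩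
      · have hfb' : 0 < fb := lt_of_le_of_ne hfb (fun e => hfb0 e.symm)
        refine Or.inr ⟨hfb', hgb', ?_⟩
        intro θ θ' hθ hθ'
        by_contra hc
        have hle : θ ≤ θ' := not_lt.mp hc
        exact h θ' ⟨affine_pos_of_le θ θ' fa fb hθ hfb hle, hθ'⟩
  · have hfb' : fb < 0 := not_le.mp hfb
    by_cases hgb : 0 < gb
    · refine Or.inl ⟨hfb', hgb, ?_⟩
      intro θ θ' hθ hθ'
      by_contra hc
      have hle : θ' ≤ θ := not_lt.mp hc
      exact h θ' ⟨affine_pos_of_ge θ θ' fa fb hθ (le_of_lt hfb') hle, hθ'⟩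
    · exfalso
      have hgb' : gb ≤ 0 := not_lt.mp hgb
      by_cases hxy : x ≤ y
      · exact h x ⟨hx, affine_pos_of_ge y x ga gb hy hgb' hxy⟩
      · exact h y ⟨affine_pos_of_ge x y fa fb hx (le_of_lt hfb') (le_of_lt (not_le.mp hxy)), hy⟩

/-- THE STEP LEMMA IN PAIR FORM (any reach). Lines `S t θ = b t + s t * θ`; if the window `[i, i+d]` is separated
somewhere, the window `[i+1, i+d+1]` is separated somewhere, and no `θ` separates both, then there are an even/odd
comparison `(e, o)` of `[i, i+d]` through the line `i` and an even/odd comparison `(e', o')` of `[i+1, i+d+1]`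
through the line `i+d+1` that are never satisfied simultaneously. (Helly's theorem in dimension one.) -/
theorem step_pair (s b : ℕ → ℝ) (i d : ℕ)
    (hA : ∃ θ : ℝ, ∀ e o : ℕ, i ≤ e → e ≤ i + d → i ≤ o → o ≤ i + d → Even e → Odd o →
      b o + s o * θ < b e + s e * θ)
    (hB : ∃ θ : ℝ, ∀ e o : ℕ, i + 1 ≤ e → e ≤ i + d + 1 → i + 1 ≤ o → o ≤ i + d + 1 → Even e → Odd o →
      b o + s o * θ < b e + s e * θ)
    (hAB : ∀ θ : ℝ, ¬ ((∀ e o : ℕ, i ≤ e → e ≤ i + d → i ≤ o → o ≤ i + d → Even e → Odd o →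
      b o + s o * θ < b e + s e * θ) ∧ (∀ e o : ℕ, i + 1 ≤ e → e ≤ i + d + 1 → i + 1 ≤ o → o ≤ i + d + 1 →
      Even e → Odd o → b o + s o * θ < b e + s e * θ))) :
    ∃ e o e' o' : ℕ,
      (Even e ∧ Odd o ∧ i ≤ e ∧ e ≤ i + d ∧ i ≤ o ∧ o ≤ i + d ∧ (e = i ∨ o = i)) ∧
      (Even e' ∧ Odd o' ∧ i + 1 ≤ e' ∧ e' ≤ i + d + 1 ∧ i + 1 ≤ o' ∧ o' ≤ i + d + 1 ∧
        (e' = i + d + 1 ∨ o' = i + d + 1)) ∧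
      ∀ θ : ℝ, ¬ (b o + s o * θ < b e + s e * θ ∧ b o' + s o' * θ < b e' + s e' * θ) := by
  classical
  by_contra hno
  obtain ⟨θA, hθA⟩ := hA
  obtain ⟨θB, hθB⟩ := hB
  -- the two families of even/odd comparisons and their solution sets
  set PA : Finset (ℕ × ℕ) :=
    ((Icc i (i + d)) ×ˢ (Icc i (i + d))).filter (fun p => Even p.1 ∧ Odd p.2) with hPA
  set PB : Finset (ℕ × ℕ) :=
    ((Icc (i + 1) (i + d + 1)) ×ˢ (Icc (i + 1) (i + d + 1))).filter (fun p => Even p.1 ∧ Odd p.2) with hPB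
  set F : ℕ × ℕ → Set ℝ := fun p => {θ : ℝ | b p.2 + s p.2 * θ < b p.1 + s p.1 * θ} with hF
  have memF : ∀ (p : ℕ × ℕ) (θ : ℝ), θ ∈ F p ↔ b p.2 + s p.2 * θ < b p.1 + s p.1 * θ := fun p θ => Iff.rfl
  have memA : ∀ p : ℕ × ℕ, p ∈ PA ↔
      ((i ≤ p.1 ∧ p.1 ≤ i + d) ∧ (i ≤ p.2 ∧ p.2 ≤ i + d)) ∧ (Even p.1 ∧ Odd p.2) := by
    intro p
    simp only [hPA, Finset.mem_filter, Finset.mem_product, Finset.mem_Icc]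
  have memB : ∀ p : ℕ × ℕ, p ∈ PB ↔
      ((i + 1 ≤ p.1 ∧ p.1 ≤ i + d + 1) ∧ (i + 1 ≤ p.2 ∧ p.2 ≤ i + d + 1)) ∧ (Even p.1 ∧ Odd p.2) := by
    intro p
    simp only [hPB, Finset.mem_filter, Finset.mem_product, Finset.mem_Icc]
  have hFA : ∀ p ∈ PA, θA ∈ F p := by
    intro p hp
    obtain ⟨⟨⟨h1, h2⟩, ⟨h3, h4⟩⟩, ⟨he, ho⟩⟩ := (memA p).1 hp
    exact (memF p θA).2 (hθA p.1 p.2 h1 h2 h3 h4 he ho)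
  have hFB : ∀ p ∈ PB, θB ∈ F p := by
    intro p hp
    obtain ⟨⟨⟨h1, h2⟩, ⟨h3, h4⟩⟩, ⟨he, ho⟩⟩ := (memB p).1 hp
    exact (memF p θB).2 (hθB p.1 p.2 h1 h2 h3 h4 he ho)
  -- a comparison private to `[i, i+d]` together with one private to `[i+1, i+d+1]` is satisfiable, because the
  -- conclusion is being denied
  have mixed : ∀ p q : ℕ × ℕ, p ∈ PA → p ∉ PB → q ∈ PB → q ∉ PA → (F p ∩ F q).Nonempty := by
    intro p q hpA hpB hqB hqA
    obtain ⟨⟨⟨h1, h2⟩, ⟨h3, h4⟩⟩, ⟨he, ho⟩⟩ := (memA p).1 hpA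
    obtain ⟨⟨⟨g1, g2⟩, ⟨g3, g4⟩⟩, ⟨ge, go⟩⟩ := (memB q).1 hqB
    have hp' : ¬ ((i + 1 ≤ p.1 ∧ p.1 ≤ i + d + 1) ∧ (i + 1 ≤ p.2 ∧ p.2 ≤ i + d + 1)) :=
      fun hh => hpB ((memB p).2 ⟨hh, ⟨he, ho⟩⟩)
    have hq' : ¬ ((i ≤ q.1 ∧ q.1 ≤ i + d) ∧ (i ≤ q.2 ∧ q.2 ≤ i + d)) :=
      fun hh => hqA ((memA q).2 ⟨hh, ⟨ge, go⟩⟩)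
    have hpi : p.1 = i ∨ p.2 = i := by omega
    have hqi : q.1 = i + d + 1 ∨ q.2 = i + d + 1 := by omega
    by_contra hnone
    apply hno
    refine ⟨p.1, p.2, q.1, q.2, ⟨he, ho, h1, h2, h3, h4, hpi⟩, ⟨ge, go, g1, g2, g3, g4, hqi⟩, ?_⟩
    intro θ hθ
    exact hnone ⟨θ, (memF p θ).2 hθ.1, (memF q θ).2 hθ.2⟩
  -- hence all pairs of comparisons of the two windows are jointly satisfiable
  have pair : ∀ p ∈ PA ∪ PB, ∀ q ∈ PA ∪ PB, (F p ∩ F q).Nonempty := by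
    intro p hp q hq
    rw [Finset.mem_union] at hp hq
    by_cases hpA : p ∈ PA
    · by_cases hqA : q ∈ PA
      · exact ⟨θA, hFA p hpA, hFA q hqA⟩
      · have hqB : q ∈ PB := hq.resolve_left hqA
        by_cases hpB : p ∈ PB
        · exact ⟨θB, hFB p hpB, hFB q hqB⟩
        · exact mixed p q hpA hpB hqB hqA
    · have hpB : p ∈ PB := hp.resolve_left hpA
      by_cases hqB : q ∈ PB
      · exact ⟨θB, hFB p hpB, hFB q hqB⟩
      · have hqA : q ∈ PA := hq.resolve_right hqB
        obtain ⟨θ, hθq, hθp⟩ := mixed q p hqA hqB hpB hpA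
        exact ⟨θ, hθp, hθq⟩
  -- Helly's theorem in dimension one
  have hconv : ∀ p ∈ PA ∪ PB, Convex ℝ (F p) := by
    intro p _
    apply Set.OrdConnected.convex
    refine ⟨fun x hx y hy z hz => ?_⟩
    rw [memF] at hx hy ⊢
    have hx' : 0 < (b p.1 - b p.2) + (s p.1 - s p.2) * x := by linarith
    have hy' : 0 < (b p.1 - b p.2) + (s p.1 - s p.2) * y := by linarith
    have := affine_pos_between x y z (b p.1 - b p.2) (s p.1 - s p.2) hx' hy' hz.1 hz.2
    linarith
  have hinter : ∀ I ⊆ PA ∪ PB, #I ≤ Module.finrank ℝ ℝ + 1 → (⋂ p ∈ I, F p).Nonempty := by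
    intro I hI hcard
    simp only [Module.finrank_self] at hcard
    rcases I.eq_empty_or_nonempty with hI0 | ⟨p, hp⟩
    · subst hI0
      exact ⟨0, by simp⟩
    · by_cases hone : ∀ q ∈ I, q = p
      · obtain ⟨θ, hθ, -⟩ := pair p (hI hp) p (hI hp)
        refine ⟨θ, ?_⟩
        simp only [Set.mem_iInter]
        intro q hq
        rw [hone q hq]
        exact hθ
      · obtain ⟨q, hq, hqp⟩ : ∃ q ∈ I, q ≠ p := by
          by_contra hh
          apply hone
          intro q hq
          by_contra hqp
          exact hh ⟨q, hq, hqp⟩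
        obtain ⟨θ, hθp, hθq⟩ := pair p (hI hp) q (hI hq)
        refine ⟨θ, ?_⟩
        simp only [Set.mem_iInter]
        intro r hr
        have hr' : r = p ∨ r = q := by
          by_contra hh
          have h3 : 2 < #I :=
            Finset.two_lt_card_iff.2 ⟨p, q, r, hp, hq, hr, hqp.symm, fun e => hh (Or.inl e.symm),
              fun e => hh (Or.inr e.symm)⟩
          omega
        rcases hr' with hr' | hr'
        · rw [hr']; exact hθp
        · rw [hr']; exact hθq
  obtain ⟨θ, hθ⟩ := Convex.helly_theorem' hconv hinter
  simp only [Set.mem_iInter] at hθ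
  apply hAB θ
  constructor
  · intro e o h1 h2 h3 h4 he ho
    exact (memF (e, o) θ).1 (hθ (e, o) (Finset.mem_union_left _ ((memA (e, o)).2 ⟨⟨⟨h1, h2⟩, ⟨h3, h4⟩⟩, ⟨he, ho⟩⟩)))
  · intro e o h1 h2 h3 h4 he ho
    exact (memF (e, o) θ).1 (hθ (e, o) (Finset.mem_union_right _ ((memB (e, o)).2 ⟨⟨⟨h1, h2⟩, ⟨h3, h4⟩⟩, ⟨he, ho⟩⟩)))

end Summit.ValiantsHypothesis.ValiantsHypothesis.Theorems.KPlusLogSqLawStepPair
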